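import Mathlib
import HarnessLib
import Literature.Analysis.FluidPDE.IsometryInvariance
import Literature.Analysis.FluidPDE.ClassicalSolutionGalilean
import Summits.NavierStokesRegularity.NavierStokesRegularity.Theorems.UnthreadedDoorNetFluxOneSidedLawCalculus
import Summits.NavierStokesRegularity.NavierStokesRegularity.Theorems.UnthreadedDoorNetFluxStratumReduction

/-!
# Route `UnthreadedDoor`, crux `PoloidalLiouville` (stmt-NavierStokesRegularity-1222), WALL W1 — second-stratum line «height-head»
# (ns-idea-14 g5, `Lines/height_head.lean` v2 0312d4da328d): stub HH-6b `CurledLawRadialGauge`, PROVED (by name)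

`NetFlux.curledLawRadialGauge : <body of HeightHead.CurledLawRadialGauge, verbatim>`: the curled potential law (E1) `CurledLaw v x₀ T 𝒯`
is invariant under smooth RADIAL gauge summands, `T̃(t,x) = T(t,x) + c(t, ‖x − x₀‖)`, for `𝒯` open, `v` smooth on `𝒯 × ℝ³`, `T` smooth on
`𝒯 × (ℝ³ ∖ {x₀})`, `c` smooth on `𝒯 × ]0,∞[`.

PROOF (pointwise at `t ∈ 𝒯`, `x ≠ x₀`, `y = x − x₀`, `g = c(t, ‖· − x₀‖)`): near `x` the (E1) operator of `T̃` splits as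
`Φ̃ = Φ + A + B − C` with `A = ∂ₜc(t, ‖· − x₀‖)`, `B = ⟪v, ∇g⟫ = k(‖· − x₀‖) · m` (`k = c_r/r`, `m = ⟪v, · − x₀⟫`, since `∇g = k · (x − x₀)`,
`hasGradientAt_radialFun`), `C = Δg`.  `A` and `C` are CONSTANT ON SPHERES about `x₀` — for `C` by the isometry invariance of the Laplacian
(tree: `laplacian_comp_linearIsometryEquiv_symm` with the reflection swapping two points of a sphere, `laplacian_comp_add_right`), no radial
Laplacian formula needed — and `C¹` off `x₀`, so their gradients are radial and `∇(·) × y = 0` (tree: `cross_gradient_eq_zero_of_sphere_const`,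
p660934); `∇B × y = m (∇(k∘‖·−x₀‖) × y) + k (∇m × y) = k (∇m × y)`.  On the right, `∇m × ∇T̃ = ∇m × ∇T + k (∇m × y)`.  Equal.
In the line: `theorem stub_curledLawRadialGauge : CurledLawRadialGauge := Theorems.PoloidalLiouville.NetFlux.curledLawRadialGauge`.

HONEST LABEL: one bookkeeping stub (gauge invariance) of a second-stratum line; `PoloidalLiouville` (1222), C⁻, W1 and the summit stay OPEN;
NO Navier–Stokes regularity statement is proved.  `--supports stmt-NavierStokesRegularity-1222 --as helper`.  [folklore]
-/

noncomputable section

-- the summit and its single sub-problem share the name (CONVENTIONS §1)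
set_option linter.dupNamespace false

open Set Function Filter Topology InnerProductSpace MeasureTheory
open scoped RealInnerProductSpace NNReal

namespace Summit.NavierStokesRegularity.NavierStokesRegularity.Theorems.PoloidalLiouville.NetFlux

open Literature.Analysis Literature.Analysis.FluidPDE

/-! ### Bilinearity of the cross product (via `crossCLM`) -/

/-- `cross` is additive in the first slot. [folklore] -/
private theorem cross_add_left₃ (a b w : E3) : cross (a + b) w = cross a w + cross b w := by
  rw [← crossCLM_apply, map_add, _root_.add_apply, crossCLM_apply, crossCLM_apply]

/-- `cross` respects subtraction in the first slot. [folklore] -/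
private theorem cross_sub_left₃ (a b w : E3) : cross (a - b) w = cross a w - cross b w := by
  rw [← crossCLM_apply, map_sub, _root_.sub_apply, crossCLM_apply, crossCLM_apply]

/-- `cross` is homogeneous in the first slot. [folklore] -/
private theorem cross_smul_left₃ (c : ℝ) (a w : E3) : cross (c • a) w = c • cross a w := by
  rw [← crossCLM_apply, map_smul, _root_.smul_apply, crossCLM_apply]

/-- `cross` is additive in the second slot. [folklore] -/
private theorem cross_add_right₃ (a b w : E3) : cross w (a + b) = cross w a + cross w b := by
  rw [← crossCLM_apply, map_add, crossCLM_apply, crossCLM_apply]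

/-- `cross` is homogeneous in the second slot. [folklore] -/
private theorem cross_smul_right₃ (c : ℝ) (a w : E3) : cross w (c • a) = c • cross w a := by
  rw [← crossCLM_apply, map_smul, crossCLM_apply]

/-! ### Gradients: sums, products, local congruence, radial functions -/

/-- Gradient of a pointwise sum. [folklore] -/
private theorem gradient_add₃ {f g : E3 → ℝ} {x : E3} (hf : DifferentiableAt ℝ f x) (hg : DifferentiableAt ℝ g x) :
    gradient (fun z => f z + g z) x = gradient f x + gradient g x := by
  unfold gradient
  rw [fderiv_fun_add hf hg, map_add]

/-- Gradient of a pointwise difference. [folklore] -/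
private theorem gradient_sub₃ {f g : E3 → ℝ} {x : E3} (hf : DifferentiableAt ℝ f x) (hg : DifferentiableAt ℝ g x) :
    gradient (fun z => f z - g z) x = gradient f x - gradient g x := by
  unfold gradient
  rw [fderiv_fun_sub hf hg, map_sub]

/-- Gradient of a pointwise product (Leibniz). [folklore] -/
private theorem gradient_mul₃ {f g : E3 → ℝ} {x : E3} (hf : DifferentiableAt ℝ f x) (hg : DifferentiableAt ℝ g x) :
    gradient (fun z => f z * g z) x = f x • gradient g x + g x • gradient f x := by
  unfold gradient
  rw [fderiv_fun_mul hf hg, map_add, map_smul, map_smul]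

/-- The gradient only depends on the germ of the function. [folklore] -/
private theorem gradient_congr₃ {f g : E3 → ℝ} {x : E3} (h : f =ᶠ[𝓝 x] g) : gradient f x = gradient g x := by
  unfold gradient
  rw [h.fderiv_eq]

/-- **Gradient of a radial function**: if `ρ` has derivative `ρ'` at `‖x − x₀‖` (`x ≠ x₀`) then `z ↦ ρ ‖z − x₀‖` has gradient
`(ρ'/‖x − x₀‖) · (x − x₀)` at `x`. [folklore] -/
theorem hasGradientAt_radialFun {ρ : ℝ → ℝ} {x₀ x : E3} (hx : x ≠ x₀) {ρ' : ℝ} (hρ : HasDerivAt ρ ρ' ‖x - x₀‖) :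
    HasGradientAt (fun z : E3 => ρ ‖z - x₀‖) ((ρ' / ‖x - x₀‖) • (x - x₀)) x := by
  have hr : 0 < ‖x - x₀‖ := norm_pos_iff.2 (sub_ne_zero.2 hx)
  -- `z ↦ ‖z − x₀‖²`
  have h1 : HasFDerivAt (fun z : E3 => ‖z - x₀‖ ^ 2) (2 • (innerSL ℝ (x - x₀)).comp (ContinuousLinearMap.id ℝ E3)) x :=
    ((hasFDerivAt_id x).sub_const x₀).norm_sq
  -- `√` at `‖x − x₀‖² ≠ 0`
  have h2 : HasDerivAt Real.sqrt (1 / (2 * Real.sqrt (‖x - x₀‖ ^ 2))) (‖x - x₀‖ ^ 2) :=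
    Real.hasDerivAt_sqrt (pow_pos hr 2).ne'
  rw [Real.sqrt_sq hr.le] at h2
  have h3 := h2.comp_hasFDerivAt x h1
  have heq : (Real.sqrt ∘ fun z : E3 => ‖z - x₀‖ ^ 2) = fun z : E3 => ‖z - x₀‖ := by
    funext z; simp [Real.sqrt_sq (norm_nonneg _)]
  rw [heq] at h3
  have h4 := hρ.comp_hasFDerivAt x h3
  rw [hasGradientAt_iff_hasFDerivAt]
  refine h4.congr_fderiv ?_
  ext w
  simp only [InnerProductSpace.toDual_apply_apply, _root_.smul_apply, ContinuousLinearMap.comp_apply,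
    ContinuousLinearMap.id_apply, innerSL_apply_apply, smul_eq_mul, nsmul_eq_mul, Nat.cast_ofNat,
    real_inner_smul_left]
  field_simp

/-! ### The Laplacian of a radial function is constant on spheres (isometry invariance) -/

/-- **`Δ` of a radial function is constant on spheres**: `Δ(ρ(‖· − x₀‖))(y) = Δ(ρ(‖· − x₀‖))(z)` when `‖y − x₀‖ = ‖z − x₀‖` (reflect `y − x₀`
onto `z − x₀`; the Laplacian commutes with isometries and translations — tree lemmas, no differentiability needed). [folklore] -/
theorem laplacian_radialFun_sphere_const (ρ : ℝ → ℝ) (x₀ : E3) {y z : E3} (h : ‖y - x₀‖ = ‖z - x₀‖) :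
    Laplacian.laplacian (fun w : E3 => ρ ‖w - x₀‖) y = Laplacian.laplacian (fun w : E3 => ρ ‖w - x₀‖) z := by
  set ψ : E3 → ℝ := fun u => ρ ‖u‖ with hψ
  -- translation: `Δ g (w) = Δ ψ (w − x₀)`
  have htr : ∀ w : E3, Laplacian.laplacian (fun w : E3 => ρ ‖w - x₀‖) w = Laplacian.laplacian ψ (w + -x₀) := by
    intro w
    have e : (fun w : E3 => ρ ‖w - x₀‖) = fun w => ψ (w + -x₀) := by
      funext w; simp [hψ, sub_eq_add_neg]
    rw [e]
    exact laplacian_comp_add_right ψ (-x₀) w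
  rw [htr y, htr z]
  -- reflection swapping `y − x₀` and `z − x₀`
  set R : E3 ≃ₗᵢ[ℝ] E3 := Submodule.reflection (ℝ ∙ ((y + -x₀) - (z + -x₀)))ᗮ with hR
  have hRy : R (y + -x₀) = z + -x₀ := by
    rw [hR]
    exact Submodule.reflection_sub (by rw [← sub_eq_add_neg, ← sub_eq_add_neg]; exact h)
  have hRsymm : R.symm (y + -x₀) = z + -x₀ := by
    rw [hR, Submodule.reflection_symm, ← hR]; exact hRy
  have hinv : (fun u : E3 => ψ (R.symm u)) = ψ := by
    funext u; simp [hψ]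
  have h1 := laplacian_comp_linearIsometryEquiv_symm R ψ (y + -x₀)
  rw [hinv, hRsymm] at h1
  exact h1

/-! ### HH-6b -/

/-- **HH-6b `CurledLawRadialGauge`, proved**: the curled potential law (E1) is invariant under smooth radial gauge summands
`T ↦ T + c(t, ‖x − x₀‖)` (statement = the line's `HeightHead.CurledLawRadialGauge` verbatim).  See the module docstring for the
computation.  No NS statement is involved. [folklore] -/
theorem curledLawRadialGauge :
    ∀ (v : ℝ → E3 → E3) (x₀ : E3) (T : ℝ → E3 → ℝ) (c : ℝ → ℝ → ℝ) (𝒯 : Set ℝ), IsOpen 𝒯 →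
    ContDiffOn ℝ (⊤ : ℕ∞) (uncurry v) (𝒯 ×ˢ (univ : Set E3)) →
    ContDiffOn ℝ (⊤ : ℕ∞) (uncurry T) (𝒯 ×ˢ ({x₀}ᶜ : Set E3)) →
    ContDiffOn ℝ (⊤ : ℕ∞) (uncurry c) (𝒯 ×ˢ Ioi (0 : ℝ)) →
    CurledLaw v x₀ T 𝒯 → CurledLaw v x₀ (fun t x => T t x + c t ‖x - x₀‖) 𝒯 := by
  intro v x₀ T c 𝒯 h𝒯 hv hT hc hE t ht x hx
  have hO : IsOpen ({x₀}ᶜ : Set E3) := isOpen_compl_singleton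
  have hW : IsOpen (𝒯 ×ˢ ({x₀}ᶜ : Set E3)) := h𝒯.prod hO
  have hWc : IsOpen (𝒯 ×ˢ Ioi (0 : ℝ)) := h𝒯.prod isOpen_Ioi
  set y : E3 := x - x₀ with hy
  have hr : 0 < ‖x - x₀‖ := norm_pos_iff.2 (sub_ne_zero.2 hx)
  -- ### slices and their regularity
  have hvt : ContDiff ℝ (⊤ : ℕ∞) (v t) := by
    have h : ContDiffOn ℝ (⊤ : ℕ∞) (uncurry v ∘ fun z : E3 => (t, z)) univ :=
      hv.comp (contDiff_prodMk_right t).contDiffOn fun z _ => ⟨ht, mem_univ z⟩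
    exact contDiffOn_univ.1 h
  have hTt : ContDiffOn ℝ (⊤ : ℕ∞) (T t) ({x₀}ᶜ : Set E3) :=
    hT.comp (contDiff_prodMk_right t).contDiffOn fun z hz => ⟨ht, hz⟩
  set ρ : ℝ → ℝ := c t with hρ
  have hρs : ContDiffOn ℝ (⊤ : ℕ∞) ρ (Ioi 0) :=
    hc.comp (contDiff_prodMk_right t).contDiffOn fun r hr' => ⟨ht, hr'⟩
  have hρd : ∀ r : ℝ, 0 < r → DifferentiableAt ℝ ρ r := fun r hr' =>
    (hρs.differentiableOn (by simp) r hr').differentiableAt (isOpen_Ioi.mem_nhds hr')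
  have hρ1 : ContDiffOn ℝ (⊤ : ℕ∞) (deriv ρ) (Ioi 0) := hρs.deriv_of_isOpen isOpen_Ioi (by simp)
  -- the norm map off the centre
  set N : E3 → ℝ := fun z => ‖z - x₀‖ with hN
  have hNc : ContDiffOn ℝ (⊤ : ℕ∞) N ({x₀}ᶜ : Set E3) := fun z hz =>
    ((contDiffAt_id.sub contDiffAt_const).norm ℝ (sub_ne_zero.2 hz)).contDiffWithinAt
  have hNpos : ∀ z : E3, z ≠ x₀ → 0 < N z := fun z hz => norm_pos_iff.2 (sub_ne_zero.2 hz)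
  have hNmaps : MapsTo N ({x₀}ᶜ : Set E3) (Ioi 0) := fun z hz => hNpos z hz
  -- the radial summand `g = ρ ∘ N` and the ratio `k = ρ'/r`
  set g : E3 → ℝ := fun z => ρ ‖z - x₀‖ with hg
  have hgs : ContDiffOn ℝ (⊤ : ℕ∞) g ({x₀}ᶜ : Set E3) := hρs.comp hNc hNmaps
  set k : ℝ → ℝ := fun r => deriv ρ r / r with hk
  have hks : ContDiffOn ℝ (⊤ : ℕ∞) k (Ioi 0) := hρ1.div contDiffOn_id fun r hr' => (ne_of_gt hr')
  have hkN : ContDiffOn ℝ (⊤ : ℕ∞) (fun z => k (N z)) ({x₀}ᶜ : Set E3) := hks.comp hNc hNmaps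
  have hgrad_g : ∀ z : E3, z ≠ x₀ → gradient g z = k (N z) • (z - x₀) := fun z hz =>
    (hasGradientAt_radialFun hz (hρd _ (hNpos z hz)).hasDerivAt).gradient
  -- differentiability at points off the centre
  have hdiff : ∀ {F : E3 → ℝ}, ContDiffOn ℝ (⊤ : ℕ∞) F ({x₀}ᶜ : Set E3) → ∀ z : E3, z ≠ x₀ → DifferentiableAt ℝ F z :=
    fun hF z hz => (hF.differentiableOn (by simp) z hz).differentiableAt (hO.mem_nhds hz)
  have hC2 : ∀ {F : E3 → ℝ}, ContDiffOn ℝ (⊤ : ℕ∞) F ({x₀}ᶜ : Set E3) → ∀ z : E3, z ≠ x₀ → ContDiffAt ℝ 2 F z :=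
    fun hF z hz => ((hF z hz).contDiffAt (hO.mem_nhds hz)).of_le (WithTop.coe_le_coe.2 le_top)
  -- ### the (E1) operator of `T` and the three extra terms
  set m : E3 → ℝ := fun z => ⟪v t z, z - x₀⟫ with hm
  have hms : ContDiff ℝ (⊤ : ℕ∞) m := hvt.inner ℝ (contDiff_id.sub contDiff_const)
  set Φ : E3 → ℝ := fun z => deriv (fun s => T s z) t + ⟪v t z, gradient (T t) z⟫ - Laplacian.laplacian (T t) z with hΦ
  set A : E3 → ℝ := fun z => deriv (fun s => c s ‖z - x₀‖) t with hA
  set B : E3 → ℝ := fun z => k (N z) * m z with hB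
  set C : E3 → ℝ := fun z => Laplacian.laplacian g z with hC
  -- regularity of `Φ` off the centre (time slice derivative, transport term, Laplacian)
  have hT₁ := (contDiffOn_deriv_tslice hW hT).2
  have hΦ1 : ContDiffOn ℝ (⊤ : ℕ∞) (fun z : E3 => deriv (fun s => T s z) t) ({x₀}ᶜ : Set E3) := by
    have h := hT₁.comp (contDiffOn_const.prodMk contDiffOn_id) fun z hz => (⟨ht, hz⟩ : ((t, z) : ℝ × E3) ∈ 𝒯 ×ˢ ({x₀}ᶜ : Set E3))
    exact h.congr fun z _ => rfl
  have hΦ2 : ContDiffOn ℝ (⊤ : ℕ∞) (fun z : E3 => ⟪v t z, gradient (T t) z⟫) ({x₀}ᶜ : Set E3) :=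
    hvt.contDiffOn.inner ℝ (contDiffOn_gradient_of_isOpen_compl hO hTt)
  have hΦ3 : ContDiffOn ℝ (⊤ : ℕ∞) (fun z : E3 => Laplacian.laplacian (T t) z) ({x₀}ᶜ : Set E3) :=
    contDiffOn_laplacian_of_isOpen hO hTt
  have hΦs : ContDiffOn ℝ (⊤ : ℕ∞) Φ ({x₀}ᶜ : Set E3) := (hΦ1.add hΦ2).sub hΦ3
  -- regularity of `A`: `A = c₁ ∘ N` with `c₁ r = D(uncurry c)(t,r)(1,0)`
  set c₁ : ℝ → ℝ := fun r => fderiv ℝ (uncurry c) (t, r) ((1 : ℝ), (0 : ℝ)) with hc₁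
  have hc₁s : ContDiffOn ℝ (⊤ : ℕ∞) c₁ (Ioi 0) := by
    have h1 : ContDiffOn ℝ (⊤ : ℕ∞) (fun q : ℝ × ℝ => fderiv ℝ (uncurry c) q ((1 : ℝ), (0 : ℝ))) (𝒯 ×ˢ Ioi (0 : ℝ)) :=
      (hc.fderiv_of_isOpen hWc (by simp)).clm_apply contDiffOn_const
    exact h1.comp (contDiffOn_const.prodMk contDiffOn_id) fun r hr' => ⟨ht, hr'⟩
  have hAeq : ∀ z : E3, z ≠ x₀ → A z = c₁ (N z) := by
    intro z hz
    have hq : ((t, N z) : ℝ × ℝ) ∈ 𝒯 ×ˢ Ioi (0 : ℝ) := ⟨ht, hNpos z hz⟩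
    have hcd : DifferentiableAt ℝ (uncurry c) (t, N z) := (hc.differentiableOn (by simp) _ hq).differentiableAt (hWc.mem_nhds hq)
    have h1 : HasDerivAt (fun s : ℝ => ((s, N z) : ℝ × ℝ)) ((1 : ℝ), (0 : ℝ)) t := (hasDerivAt_id t).prodMk (hasDerivAt_const t (N z))
    exact (hcd.hasFDerivAt.comp_hasDerivAt t h1).deriv
  have hAs : ContDiffOn ℝ (⊤ : ℕ∞) A ({x₀}ᶜ : Set E3) := (hc₁s.comp hNc hNmaps).congr fun z hz => hAeq z hz
  -- regularity of `B`, `C`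
  have hBs : ContDiffOn ℝ (⊤ : ℕ∞) B ({x₀}ᶜ : Set E3) := hkN.mul hms.contDiffOn
  have hCs : ContDiffOn ℝ (⊤ : ℕ∞) C ({x₀}ᶜ : Set E3) := contDiffOn_laplacian_of_isOpen hO hgs
  -- ### `A` and `C` have radial gradients
  have hAcross : cross (gradient A x) (x - x₀) = 0 :=
    cross_gradient_eq_zero_of_sphere_const (hAs.differentiableOn (by simp)) (fun y' z' hyz => by simp only [hA, hyz]) x
  have hCcross : cross (gradient C x) (x - x₀) = 0 :=
    cross_gradient_eq_zero_of_sphere_const (hCs.differentiableOn (by simp))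
      (fun y' z' hyz => laplacian_radialFun_sphere_const ρ x₀ hyz) x
  have hkNcross : cross (gradient (fun z => k (N z)) x) (x - x₀) = 0 :=
    cross_gradient_eq_zero_of_sphere_const (hkN.differentiableOn (by simp)) (fun y' z' hyz => by simp only [hN, hyz]) x
  -- ### the (E1) operator of `T̃` equals `Φ + A + B − C` near `x`
  have hsplit : (fun z => deriv (fun s => T s z + c s ‖z - x₀‖) t
        + ⟪v t z, gradient (fun w => T t w + c t ‖w - x₀‖) z⟫ - Laplacian.laplacian (fun w => T t w + c t ‖w - x₀‖) z)
      =ᶠ[𝓝 x] fun z => Φ z + A z + B z - C z := by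
    filter_upwards [hO.mem_nhds hx] with z hz
    have hz' : z ≠ x₀ := hz
    -- time derivative
    have hq : ((t, z) : ℝ × E3) ∈ 𝒯 ×ˢ ({x₀}ᶜ : Set E3) := ⟨ht, hz⟩
    have hTd : DifferentiableAt ℝ (fun s => T s z) t := by
      have hd : DifferentiableAt ℝ (uncurry T) (t, z) := (hT.differentiableOn (by simp) _ hq).differentiableAt (hW.mem_nhds hq)
      have e : (fun s : ℝ => T s z) = uncurry T ∘ fun s => (s, z) := rfl
      rw [e]; exact hd.comp t (differentiableAt_id.prodMk (differentiableAt_const z))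
    have hcq : ((t, N z) : ℝ × ℝ) ∈ 𝒯 ×ˢ Ioi (0 : ℝ) := ⟨ht, hNpos z hz'⟩
    have hcd' : DifferentiableAt ℝ (fun s => c s ‖z - x₀‖) t := by
      have hd : DifferentiableAt ℝ (uncurry c) (t, N z) := (hc.differentiableOn (by simp) _ hcq).differentiableAt (hWc.mem_nhds hcq)
      have e : (fun s : ℝ => c s ‖z - x₀‖) = uncurry c ∘ fun s => (s, N z) := rfl
      rw [e]; exact hd.comp t (differentiableAt_id.prodMk (differentiableAt_const _))
    have h1 : deriv (fun s => T s z + c s ‖z - x₀‖) t = deriv (fun s => T s z) t + A z := by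
      simp only [hA]
      exact deriv_fun_add hTd hcd'
    -- gradient of the slice
    have h2 : gradient (fun w => T t w + c t ‖w - x₀‖) z = gradient (T t) z + k (N z) • (z - x₀) := by
      rw [gradient_add₃ (hdiff hTt z hz') (hdiff hgs z hz'), ← hgrad_g z hz']
    -- Laplacian of the slice
    have h3 : Laplacian.laplacian (fun w => T t w + c t ‖w - x₀‖) z = Laplacian.laplacian (T t) z + C z := by
      have e : (fun w => T t w + c t ‖w - x₀‖) = T t + g := rfl
      rw [e]
      exact (hC2 hTt z hz').laplacian_add (hC2 hgs z hz')
    rw [h1, h2, h3, inner_add_right, real_inner_smul_right]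
    simp only [hΦ, hB, hm]
    ring
  -- ### gradients at `x`
  have hdΦ := hdiff hΦs x hx
  have hdA := hdiff hAs x hx
  have hdB := hdiff hBs x hx
  have hdC := hdiff hCs x hx
  have hgradL : gradient (fun z => deriv (fun s => T s z + c s ‖z - x₀‖) t
        + ⟪v t z, gradient (fun w => T t w + c t ‖w - x₀‖) z⟫ - Laplacian.laplacian (fun w => T t w + c t ‖w - x₀‖) z) x
      = gradient Φ x + gradient A x + gradient B x - gradient C x := by
    have hdΦA : DifferentiableAt ℝ (fun z => Φ z + A z) x := hdΦ.add hdA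
    have hdΦAB : DifferentiableAt ℝ (fun z => Φ z + A z + B z) x := hdΦA.add hdB
    rw [gradient_congr₃ hsplit, gradient_sub₃ (f := fun z => Φ z + A z + B z) (g := C) hdΦAB hdC,
      gradient_add₃ (f := fun z => Φ z + A z) (g := B) hdΦA hdB, gradient_add₃ (f := Φ) (g := A) hdΦ hdA]
  have hgradB : gradient B x = m x • gradient (fun z => k (N z)) x + k (N x) • gradient m x := by
    have h := gradient_mul₃ (hdiff hkN x hx) (hms.differentiable (by simp) x)
    simp only [hB] at h ⊢
    rw [h]
    abel
  have hgradT' : gradient (fun w => T t w + c t ‖w - x₀‖) x = gradient (T t) x + k (N x) • (x - x₀) := by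
    rw [gradient_add₃ (hdiff hTt x hx) (hdiff hgs x hx), ← hgrad_g x hx]
  -- ### conclude
  have hEx := hE t ht x hx
  show cross (gradient (fun z => deriv (fun s => T s z + c s ‖z - x₀‖) t
        + ⟪v t z, gradient (fun w => T t w + c t ‖w - x₀‖) z⟫ - Laplacian.laplacian (fun w => T t w + c t ‖w - x₀‖) z) x) (x - x₀)
      = cross (gradient (fun z => ⟪v t z, z - x₀⟫) x) (gradient (fun w => T t w + c t ‖w - x₀‖) x)
  rw [hgradL, hgradT', cross_sub_left₃, cross_add_left₃, cross_add_left₃, hAcross, hCcross, hgradB, cross_add_left₃,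
    cross_smul_left₃, cross_smul_left₃, hkNcross, cross_add_right₃, cross_smul_right₃]
  have e : (fun z => ⟪v t z, z - x₀⟫) = m := rfl
  rw [e] at hEx ⊢
  rw [hEx]
  simp only [smul_zero, add_zero, sub_zero, zero_add]

end Summit.NavierStokesRegularity.NavierStokesRegularity.Theorems.PoloidalLiouville.NetFlux

end
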